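import Summits.QuantumFields.YangMills.Theorems.BalabanUVNodesN21LowCentreEndAtSUNBlockChart

/-!
# N21 (NE7c) · THE [LF-II] §1-LETTERS END ON THE EXPONENTIAL `SU(N)` BLOCK CHART, II: the chart-letter species ★★★★, the END AT
# ONE BLOCK ∕ TERM FIBRE LAW OF THE RECORD through dag-n21-w2's JUNCTION №3 (p600281) WITHOUT the two-ratio dictionary, A6 witnesses

Width seat pub-ymgap-dag-n21-w1 (g2; director-ym №197 ∕ HUMAN RULING D-0149), node N21 = NE7c (single-run shell-weight
bound, NOT PRINTED in [Bałaban 1983–89], NOT proved), lane K3⁷ `SpineGivenEndpointR13SepCoPH` (stmt-QuantumFields-20544,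
`--kind proof --supports … --as helper`).  Tenth file of the seat's item-1 chain; companion of file 9
`…N21LowCentreEndAtSUNBlockChart` (★★★ `slotAntiConcentration_blockChartSU_of_sect1Letters`: p590709's END on the cut chart law
of `BlockChartSU N b`).  Consumes BY NAME: file 9, dag-n21-w2's p600281 `slotAC_blockFibreLaw_of_chartAC` ∕
`slotAC_termFibreLaw_of_chartAC`, dag-n21-d's Defs (`blockFibreLawOfDatum₉`, `termFibreLawOfDatum₉`, `blockReading`), pub-balaban's
chart modules (`BlockChartSU`, `expFibreChartSU`, `chartWeightSU`, `expJacWeightSU`, `kappaSU`, `windowSU`, `blockLaw`, `dimSU_eq`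
— credited).  THEOREMS ONLY: 0 `def`, 0 `sorry`; count-neutral.

WHAT IS PROVED ([textbook] + composition BY NAME).
* §2 ★★★★ `slotAntiConcentration_blockChartSU_chartLetter`: file 9 ★★★ with the statistic = the chart's own letter
  `‖z‖ = max_{b′} ‖B′(b′)‖_{E_N}`; every geometric binder (`hU` with `L = 1`, `hUc` with `σ = 0`, `henv`, `hRT` with `κ₀ = 1`,
  `hQ` with `Q = 0`) DISCHARGED; displayed: kept CONVEX cuts `K ∋ 0`, CONVEX exponent with the (1.2) expansion, the rows
  `Ineq19 (Q v) (Σ_{b′} ‖v b′‖²) γ₀ d M` ∕ `Ineq16`, `|Vt v| ≤ W_V`, and `16·W·d·(100M)^{d+1}·d_N ≤ γ₀(θ(1−ρ))²`.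
* §3 ★★★ `fibreAC_of_sect1Letters_expChartSU` ∕ `termFibreAC_of_sect1Letters_expChartSU`: AT ONE BLOCK ∕ TERM FIBRE LAW OF
  THE RECORD through p600281 — displayed: the window factorisation `hlaw` (dag-n21-w2's letter), ONE density presentation
  `hdens : chartWeightSU b S (expJacWeightSU κ_N) · R ∘ expFibreChartSU b c =ᵐ 𝟙_{U<θ}∩C · 𝟙_K · e^{−φ}` (`volume`-a.e. —
  the tree's `expJacSU` vanishes on the null non-regular cone, cf. pub-balaban `ShellMeasureLogConcaveSUN` §3's a.e.
  Jacobian swap), the reading identity `hread : blockReading u b x ∘ expFibreChartSU b c = U` ON THE WINDOW `‖z‖ ≤ S` ONLY,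
  and file 9's chart binders for `U` ⇒
  `SlotAntiConcentration (blockFibreLawOfDatum₉ … t a b x) (blockReading N u b x) θ ρ (3(#b·d_N+1)(1+Q)∕(κ₀(1−ρ)))` — the
  per-fibre `hfib` input of dag-n21-d's ★★★★ `shellWeightBound_crOfRecord₁₃At_shellSplit_of_blockFibreAC` ∕ p598391, with NO
  `M₁`∕`M₂` dictionary (p596527 ∕ p598905's `hS`∕`hmass` are gone: the law identity + ONE density presentation replace them).
* §4 A6 (director-ym STANDING A6 RULE №189 (3)) `convexOn_halfSumNormSq` · `chartLetter_blockChartSU_binders_inhabited`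
  (EVERY binder of ★★★★ discharged in the kernel at `N = 2`, for every nonempty block of every lattice: `K = univ`,
  `φ = ½Σ‖B′(b′)‖²`, rows at `γ₀ = 1, d = 1, M = 1∕100, B₃ = 1∕144`, `θ = 2, ρ = ½`; with `dimSU 2 = 3` the clause
  `16·(1∕48)·1·1·3 = 1 = (2·½)²` WITH EQUALITY) · `chartLetter_blockChartSU_binders_inhabited_oneBond` (… at a concrete bond).

HONEST FRAMING.  [textbook] convexity ∕ real arithmetic + composition BY NAME of landed files; the located letters — `hlaw`
(small-field window factorisation of the dressed fibre density), `hdens` (log-concavity of the exponential Haar Jacobian on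
the window — PROVED in pub-balaban's `ShellMeasureLogConcaveJacobianSUN`, NOT consumed here — plus CONVEXITY of the (1.2)
exponent on the chart, desk (t4)), the identification of the rows `Ineq16`∕`Ineq19` with the N21 slot's block action — are
HYPOTHESES; nothing of Bałaban's asserted; NE7c NOT PRINTED ∕ NOT proved; N21 NOT discharged; K3⁷ NOT claimed; counts
unmoved (typed 28∕28 · discharged 5∕27); never a count claim; one finite 𝕋⁴ at fixed ε — R4 would close only the
conditional finite-𝕋⁴ rung `BalabanLadder.UV`, NOT the Yang–Mills mass gap (Clay); nothing about ℝ⁴ ∕ OS.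
-/

set_option autoImplicit false

noncomputable section

open MeasureTheory Set Function Finset Metric
open scoped ENNReal BigOperators

namespace Summit.QuantumFields.YangMills.Theorems.N21LowCentreEndAtSUNBlockChartRecord

open Literature.MathematicalPhysics.QuantumFieldTheory.Balaban1983to89
open Literature.MathematicalPhysics.QuantumFieldTheory.Balaban1983to89.T4Continuum
open Literature.MathematicalPhysics.QuantumFieldTheory.Balaban1983to89.Node00 hiding dimSU
open Literature.MathematicalPhysics.QuantumFieldTheory.Balaban1983to89.T4ShellMeasure (SlotAntiConcentration)
open Literature.MathematicalPhysics.QuantumFieldTheory.Balaban1983to89.T4ShellMeasureDet (blockLaw)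
open Literature.MathematicalPhysics.QuantumFieldTheory.Balaban1983to89.B16Sect1Wilson (Ineq16 Ineq19)
open Summit.QuantumFields.BalabanUV.T4Continuum.ShellMeasureExpChartSUN
  (SUN ChartSU BlockChartSU dimSU dimSU_eq expFibreChartSU measurable_expFibreChartSU chartWeightSU)
open Summit.QuantumFields.BalabanUV.T4Continuum.ShellMeasureScalingSUN (windowSU)
open Summit.QuantumFields.BalabanUV.T4Continuum.ShellMeasureExpJacobianSUN (expJacWeightSU)
open Summit.QuantumFields.BalabanUV.T4Continuum.ShellMeasureExpHaarAreaSUN (kappaSU)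
open Summit.QuantumFields.YangMills.Theorems.N21ShellSplitOfRecord13CoPH (blockReading blockFibreLawOfDatum₉ termFibreLawOfDatum₉)
open Summit.QuantumFields.YangMills.Theorems.N21DilationRoadAtRecord13CoPH
  (measurable_blockReading slotAC_blockFibreLaw_of_chartAC slotAC_termFibreLaw_of_chartAC)
open Summit.QuantumFields.YangMills.Theorems.N21LowCentreEndAtSUNBlockChart
  (slotAntiConcentration_congr_support slotAntiConcentration_blockChartSU_of_sect1Letters)

/-! ## §2  ★★★★ The chart-letter species on the block chart space: every geometric binder discharged -/

section ChartLetter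

variable {N : ℕ} {P : Params} {j : ℕ}

/-- ★★★★ **(M1) FOR THE CHART's OWN LETTER `‖z‖ = max_{b′} ‖B′(b′)‖` UNDER THE CUT (1.2) CHART LAW, FROM PRINTED ROWS +
CONVEXITY + ONE CLAUSE.**  §1 with `U = ‖·‖` (`L = 1`, `σ = 0`), `C = univ`, `Env = {‖z‖ < θ}` (`Q = 0`), `κ₀ = 1`
DISCHARGED.  Displayed: kept CONVEX cuts `K ∋ 0`, CONVEX exponent with the (1.2) expansion, (1.9)
`Ineq19 (Q v) (Σ_{b′} ‖v b′‖²) γ₀ d M`, (1.6) `Ineq16 (lin v) …`, `|Vt v| ≤ W_V`, and `16·W·d·(100M)^{d+1}·d_N ≤ γ₀·(θ(1−ρ))²`.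
Constant `3(#b·d_N+1)(1+0)∕(1·(1−ρ))`. [textbook] -/
theorem slotAntiConcentration_blockChartSU_chartLetter (hN : 2 ≤ N) (b : Finset (PBond P j)) (hb : b.Nonempty)
    (K : Set (BlockChartSU N b)) (φ Qf lin Vt : BlockChartSU N b → ℝ)
    (hg : Measurable fun z : BlockChartSU N b => K.indicator (fun w => ENNReal.ofReal (Real.exp (-φ w))) z)
    {θ ρ γ₀ M B₃ M₀ A₀ p₀g Rk WV : ℝ} {d : ℕ}
    (hθ : 0 < θ) (hρ0 : 0 < ρ) (hρ1 : ρ < 1) (hd : 1 ≤ d) (hM : 0 < M) (hγ₀ : 0 < γ₀)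
    (hW : 0 ≤ 3 * B₃ * M₀ * A₀ ^ 2 * p₀g ^ 2 * Real.exp (-Rk) * (100 * M) ^ 4 + WV)
    (hK : Convex ℝ K) (hφ : ConvexOn ℝ K φ) (h0K : (0 : BlockChartSU N b) ∈ K)
    (hexp : ∀ v ∈ K, φ v = φ 0 + 1 / 2 * Qf v + lin v + Vt v)
    (h19 : ∀ v ∈ K, Ineq19 (Qf v) (∑ i, ‖v i‖ ^ 2) γ₀ d M)
    (h16 : ∀ v ∈ K, Ineq16 (lin v) B₃ M₀ A₀ p₀g Rk M)
    (hV : ∀ v ∈ K, |Vt v| ≤ WV)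
    (hclause : 16 * (3 * B₃ * M₀ * A₀ ^ 2 * p₀g ^ 2 * Real.exp (-Rk) * (100 * M) ^ 4 + WV) * d
      * (100 * M) ^ (d + 1) * dimSU N ≤ γ₀ * (θ * (1 - ρ)) ^ 2) :
    SlotAntiConcentration
      (((volume : Measure (BlockChartSU N b)).withDensity fun z =>
          K.indicator (fun w => ENNReal.ofReal (Real.exp (-φ w))) z).restrict
        ({z : BlockChartSU N b | ‖z‖ < θ} ∩ univ))
      (fun z : BlockChartSU N b => ‖z‖) θ ρ (3 * ((b.card : ℝ) * dimSU N + 1) * (1 + 0) / (1 * (1 - ρ))) := by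
  have hUm : Measurable fun z : BlockChartSU N b => ‖z‖ := measurable_norm
  have hEnv : MeasurableSet {z : BlockChartSU N b | ‖z‖ < θ} := measurableSet_lt hUm measurable_const
  refine slotAntiConcentration_blockChartSU_of_sect1Letters hN b hb K φ Qf lin Vt hg hUm MeasurableSet.univ hEnv
    (Env := {z : BlockChartSU N b | ‖z‖ < θ}) (σ := 0) (κ₀ := 1) (Q := 0) (L := 1)
    hθ hρ0 hρ1 (by linarith) one_pos le_rfl one_pos hd hM hγ₀ hW hK hφ h0K hexp h19 h16 hV ?_ ?_ ?_ ?_ ?_ ?_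
  · -- hU: the norm is 1-Lipschitz
    intro a a'
    rw [one_mul]
    exact (le_abs_self _).trans (abs_norm_sub_norm_le a a')
  · -- hUc: the centre reads 0
    simp
  · -- the clause (σ = 0, L = 1)
    simpa using hclause
  · -- henv: `‖l • z‖ = l‖z‖ < θ` for `l ∈ [l₀, 1]`
    intro l hl z _ h2 _
    have hl0 : 0 ≤ l := by
      have hx : (0 : ℝ) ≤ (b.card : ℝ) * dimSU N := by positivity
      have : 1 / ((b.card : ℝ) * dimSU N + 1) ≤ 1 := by
        rw [div_le_one (by positivity)]
        linarith
      linarith [hl.1]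
    show ‖l • z‖ < θ
    rw [norm_smul, Real.norm_of_nonneg hl0]
    calc l * ‖z‖ ≤ 1 * ‖z‖ := mul_le_mul_of_nonneg_right hl.2 (norm_nonneg _)
      _ = ‖z‖ := one_mul _
      _ < θ := h2
  · -- hRT: `‖s • z‖ = s‖z‖` grows at rate `‖z‖ ≥ θ(1−ρ)` per unit dilation (κ₀ = 1)
    intro z h1 _ _ s hs _ _ _
    rw [norm_smul, Real.norm_of_nonneg (by linarith : (0 : ℝ) ≤ s)]
    nlinarith [mul_le_mul_of_nonneg_left h1 (show (0 : ℝ) ≤ s - 1 by linarith)]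
  · -- hQ: the envelope IS the sub-level event (Q = 0)
    have hempty : {z : BlockChartSU N b | ‖z‖ < θ} \ ({z : BlockChartSU N b | ‖z‖ < θ} ∩ univ) = ∅ := by
      ext z
      simp
    rw [hempty, measure_empty]
    exact zero_le

end ChartLetter

/-! ## §3  ★★★ AT ONE BLOCK ∕ TERM FIBRE LAW OF THE RECORD, through dag-n21-w2's JUNCTION №3 (p600281) BY NAME -/

section AtRecord

variable (F : T4Family) (N : ℕ) [NeZero N] (ϑ : Stage9Params F N) (Dt : FiniteEpsData F (SU N)) (g₀ : ℕ → ℝ)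
  (os : List (ULoop F)) (p : B12.RunParams) (g : ℕ → ℝ) (k : ℕ)

/-- ★★★ **THE [LF-II] §1-LETTERS END AT ONE BLOCK FIBRE LAW OF THE RECORD, THROUGH THE EXPONENTIAL `SU(N)` BLOCK CHART.**
One truncated-law fibre (source `t`, top cube `a`, nonempty bond block `b`, exterior `x`; `2 ≤ N`).  Displayed: dag-n21-w2's
window factorisation `hlaw : blockFibreLawOfDatum₉ … t a b x = (blockLaw b).withDensity (windowSU b c S · R)` (`0 ≤ S ≤ π`,
`R` measurable); ONE density presentation of the windowed, Jacobian-weighted chart density as the cut log-concave density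
of §1, `hdens : chartWeightSU b S (expJacWeightSU κ_N) · R ∘ expFibreChartSU b c = 𝟙_{U<θ}∩C · 𝟙_K · e^{−φ}`; the reading
identity `hread : blockReading u b x ∘ expFibreChartSU b c = U` ON THE WINDOW `‖z‖ ≤ S` ONLY; and §1's chart binders for
`U` ⇒ `SlotAntiConcentration (blockFibreLawOfDatum₉ … t a b x) (blockReading N u b x) θ ρ (3(#b·d_N+1)(1+Q)∕(κ₀(1−ρ)))` —
the per-fibre `hfib` input of dag-n21-d's ★★★★ `shellWeightBound_crOfRecord₁₃At_shellSplit_of_blockFibreAC` ∕ p598391, with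
no `M₁`∕`M₂` dictionary.  LOCATED junction (`hlaw`, `hdens`, the rows' identification are hypotheses). [bookkeeping] -/
theorem fibreAC_of_sect1Letters_expChartSU (hN : 2 ≤ N) (t : ℝ)
    (a : ↥(cubeIndices (F.P p.K) (cubeSide (F.P p.K).L ϑ.ν.M₂ (RkOfRecord (F.P p.K).L ϑ.ν.r (g k)) k)))
    (b : Finset (PBond (F.P p.K) k)) (hb : b.Nonempty) (x : GaugeField (F.P p.K) k (SU N))
    {S : ℝ} (hS : 0 ≤ S) (hSπ : S ≤ Real.pi) (c : GaugeField (F.P p.K) k (SU N))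
    {R : (↥b → SU N) → ℝ≥0∞} (hR : Measurable R)
    (hlaw : blockFibreLawOfDatum₉ F N ϑ Dt g₀ os p g k t a b x = (blockLaw b).withDensity fun y => windowSU b c S y * R y)
    {u : GaugeField (F.P p.K) k (SU N) → ℝ} (hu : Measurable u)
    -- §1's frame on the chart space
    (K : Set (BlockChartSU N b)) (φ Qf lin Vt : BlockChartSU N b → ℝ)
    (hg : Measurable fun z : BlockChartSU N b => K.indicator (fun w => ENNReal.ofReal (Real.exp (-φ w))) z)
    {U : BlockChartSU N b → ℝ} (hUm : Measurable U)
    {C Env : Set (BlockChartSU N b)} (hC : MeasurableSet C) (hEnv : MeasurableSet Env)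
    {θ ρ σ κ₀ Q L γ₀ M B₃ M₀ A₀ p₀g Rk WV : ℝ} {d : ℕ}
    (hθ : 0 < θ) (hρ0 : 0 < ρ) (hρ1 : ρ < 1) (hρσ : ρ + σ ≤ 1) (hκ : 0 < κ₀) (hQ0 : 0 ≤ Q) (hL : 0 < L)
    (hd : 1 ≤ d) (hM : 0 < M) (hγ₀ : 0 < γ₀)
    (hW : 0 ≤ 3 * B₃ * M₀ * A₀ ^ 2 * p₀g ^ 2 * Real.exp (-Rk) * (100 * M) ^ 4 + WV)
    (hK : Convex ℝ K) (hφ : ConvexOn ℝ K φ) (h0K : (0 : BlockChartSU N b) ∈ K)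
    (hexp : ∀ v ∈ K, φ v = φ 0 + 1 / 2 * Qf v + lin v + Vt v)
    (h19 : ∀ v ∈ K, Ineq19 (Qf v) (∑ i, ‖v i‖ ^ 2) γ₀ d M)
    (h16 : ∀ v ∈ K, Ineq16 (lin v) B₃ M₀ A₀ p₀g Rk M)
    (hV : ∀ v ∈ K, |Vt v| ≤ WV)
    (hUL : ∀ z z' : BlockChartSU N b, U z - U z' ≤ L * ‖z - z'‖)
    (hUc : U 0 ≤ σ * θ)
    (hclause : 16 * (3 * B₃ * M₀ * A₀ ^ 2 * p₀g ^ 2 * Real.exp (-Rk) * (100 * M) ^ 4 + WV) * d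
      * (100 * M) ^ (d + 1) * (dimSU N * L ^ 2) ≤ γ₀ * (θ * (1 - ρ - σ)) ^ 2)
    (henv : ∀ l ∈ Icc (1 - 1 / ((b.card : ℝ) * dimSU N + 1)) 1, ∀ z : BlockChartSU N b,
      θ * (1 - ρ) ≤ U z → U z < θ → z ∈ C → l • z ∈ Env)
    (hRT : ∀ z : BlockChartSU N b, θ * (1 - ρ) ≤ U z → U z < θ → z ∈ C → ∀ s : ℝ, 1 ≤ s →
      θ * (1 - ρ) ≤ U (s • z) → U (s • z) < θ → s • z ∈ C → U z + κ₀ * (θ * (1 - ρ)) * (s - 1) ≤ U (s • z))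
    (hQ : ((volume : Measure (BlockChartSU N b)).withDensity fun z =>
        K.indicator (fun w => ENNReal.ofReal (Real.exp (-φ w))) z) (Env \ ({z | U z < θ} ∩ C))
      ≤ ENNReal.ofReal Q * ((volume : Measure (BlockChartSU N b)).withDensity fun z =>
        K.indicator (fun w => ENNReal.ofReal (Real.exp (-φ w))) z) ({z | U z < θ} ∩ C))
    -- the reading identity on the window and the density presentation
    (hread : ∀ z ∈ closedBall (0 : BlockChartSU N b) S, blockReading N u b x (expFibreChartSU b c z) = U z)
    (hdens : (fun z : BlockChartSU N b => chartWeightSU b S (expJacWeightSU (kappaSU N)) z * R (expFibreChartSU b c z))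
      =ᵐ[volume] ({z | U z < θ} ∩ C).indicator fun z => K.indicator (fun w => ENNReal.ofReal (Real.exp (-φ w))) z) :
    SlotAntiConcentration (blockFibreLawOfDatum₉ F N ϑ Dt g₀ os p g k t a b x) (blockReading N u b x) θ ρ
      (3 * ((b.card : ℝ) * dimSU N + 1) * (1 + Q) / (κ₀ * (1 - ρ))) := by
  have hA : MeasurableSet ({z | U z < θ} ∩ C) := (measurableSet_lt hUm measurable_const).inter hC
  -- §1 on the chart space, in `withDensity`-of-indicator form
  have h1 := slotAntiConcentration_blockChartSU_of_sect1Letters hN b hb K φ Qf lin Vt hg hUm hC hEnv hθ hρ0 hρ1 hρσ hκ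
    hQ0 hL hd hM hγ₀ hW hK hφ h0K hexp h19 h16 hV hUL hUc hclause henv hRT hQ
  rw [restrict_withDensity hA, ← withDensity_indicator hA, ← withDensity_congr_ae hdens] at h1
  -- the chart law is carried by the window: pass from `U` to the block reading read in the chart
  have hform : (fun z : BlockChartSU N b => chartWeightSU b S (expJacWeightSU (kappaSU N)) z * R (expFibreChartSU b c z)) =
      (closedBall (0 : BlockChartSU N b) S).indicator
        fun z => (∏ i, expJacWeightSU (kappaSU N) (z i)) * R (expFibreChartSU b c z) := by
    funext z
    show (closedBall (0 : BlockChartSU N b) S).indicator (fun z' => ∏ i, expJacWeightSU (kappaSU N) (z' i)) z *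
        R (expFibreChartSU b c z) = _
    exact (Set.indicator_mul_left (closedBall (0 : BlockChartSU N b) S)
      (fun z' => ∏ i, expJacWeightSU (kappaSU N) (z' i)) fun z' => R (expFibreChartSU b c z')).symm
  rw [hform] at h1
  have h2 : SlotAntiConcentration ((volume : Measure (BlockChartSU N b)).withDensity
      ((closedBall (0 : BlockChartSU N b) S).indicator
        fun z => (∏ i, expJacWeightSU (kappaSU N) (z i)) * R (expFibreChartSU b c z)))
      (blockReading N u b x ∘ expFibreChartSU b c) θ ρ (3 * ((b.card : ℝ) * dimSU N + 1) * (1 + Q) / (κ₀ * (1 - ρ))) :=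
    slotAntiConcentration_congr_support volume measurableSet_closedBall _ (fun z hz => (hread z hz).symm) h1
  rw [← hform] at h2
  exact slotAC_blockFibreLaw_of_chartAC F N ϑ Dt g₀ os p g k t a b x hS hSπ c hR hlaw (measurable_blockReading hu b x) h2

/-- ★★★ **THE SAME AT ONE TERM's FIBRE LAW** `termFibreLawOfDatum₉ … t s b x` (dag-n21-d's FILE 7 ∕ Defs v1.2 — ONE (2.18)
history's dressed integrand, where the window factorisation about that history's background is natural), through
p600281 `slotAC_termFibreLaw_of_chartAC`.  LOCATED junction. [bookkeeping] -/
theorem termFibreAC_of_sect1Letters_expChartSU (hN : 2 ≤ N) (t : ℝ) (s : SeqOfRecord F ϑ.ν ϑ.τ9.M g p.K k)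
    (b : Finset (PBond (F.P p.K) k)) (hb : b.Nonempty) (x : GaugeField (F.P p.K) k (SU N))
    {S : ℝ} (hS : 0 ≤ S) (hSπ : S ≤ Real.pi) (c : GaugeField (F.P p.K) k (SU N))
    {R : (↥b → SU N) → ℝ≥0∞} (hR : Measurable R)
    (hlaw : termFibreLawOfDatum₉ F N ϑ Dt g₀ os p g k t s b x = (blockLaw b).withDensity fun y => windowSU b c S y * R y)
    {u : GaugeField (F.P p.K) k (SU N) → ℝ} (hu : Measurable u)
    (K : Set (BlockChartSU N b)) (φ Qf lin Vt : BlockChartSU N b → ℝ)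
    (hg : Measurable fun z : BlockChartSU N b => K.indicator (fun w => ENNReal.ofReal (Real.exp (-φ w))) z)
    {U : BlockChartSU N b → ℝ} (hUm : Measurable U)
    {C Env : Set (BlockChartSU N b)} (hC : MeasurableSet C) (hEnv : MeasurableSet Env)
    {θ ρ σ κ₀ Q L γ₀ M B₃ M₀ A₀ p₀g Rk WV : ℝ} {d : ℕ}
    (hθ : 0 < θ) (hρ0 : 0 < ρ) (hρ1 : ρ < 1) (hρσ : ρ + σ ≤ 1) (hκ : 0 < κ₀) (hQ0 : 0 ≤ Q) (hL : 0 < L)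
    (hd : 1 ≤ d) (hM : 0 < M) (hγ₀ : 0 < γ₀)
    (hW : 0 ≤ 3 * B₃ * M₀ * A₀ ^ 2 * p₀g ^ 2 * Real.exp (-Rk) * (100 * M) ^ 4 + WV)
    (hK : Convex ℝ K) (hφ : ConvexOn ℝ K φ) (h0K : (0 : BlockChartSU N b) ∈ K)
    (hexp : ∀ v ∈ K, φ v = φ 0 + 1 / 2 * Qf v + lin v + Vt v)
    (h19 : ∀ v ∈ K, Ineq19 (Qf v) (∑ i, ‖v i‖ ^ 2) γ₀ d M)
    (h16 : ∀ v ∈ K, Ineq16 (lin v) B₃ M₀ A₀ p₀g Rk M)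
    (hV : ∀ v ∈ K, |Vt v| ≤ WV)
    (hUL : ∀ z z' : BlockChartSU N b, U z - U z' ≤ L * ‖z - z'‖)
    (hUc : U 0 ≤ σ * θ)
    (hclause : 16 * (3 * B₃ * M₀ * A₀ ^ 2 * p₀g ^ 2 * Real.exp (-Rk) * (100 * M) ^ 4 + WV) * d
      * (100 * M) ^ (d + 1) * (dimSU N * L ^ 2) ≤ γ₀ * (θ * (1 - ρ - σ)) ^ 2)
    (henv : ∀ l ∈ Icc (1 - 1 / ((b.card : ℝ) * dimSU N + 1)) 1, ∀ z : BlockChartSU N b,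
      θ * (1 - ρ) ≤ U z → U z < θ → z ∈ C → l • z ∈ Env)
    (hRT : ∀ z : BlockChartSU N b, θ * (1 - ρ) ≤ U z → U z < θ → z ∈ C → ∀ s' : ℝ, 1 ≤ s' →
      θ * (1 - ρ) ≤ U (s' • z) → U (s' • z) < θ → s' • z ∈ C → U z + κ₀ * (θ * (1 - ρ)) * (s' - 1) ≤ U (s' • z))
    (hQ : ((volume : Measure (BlockChartSU N b)).withDensity fun z =>
        K.indicator (fun w => ENNReal.ofReal (Real.exp (-φ w))) z) (Env \ ({z | U z < θ} ∩ C))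
      ≤ ENNReal.ofReal Q * ((volume : Measure (BlockChartSU N b)).withDensity fun z =>
        K.indicator (fun w => ENNReal.ofReal (Real.exp (-φ w))) z) ({z | U z < θ} ∩ C))
    (hread : ∀ z ∈ closedBall (0 : BlockChartSU N b) S, blockReading N u b x (expFibreChartSU b c z) = U z)
    (hdens : (fun z : BlockChartSU N b => chartWeightSU b S (expJacWeightSU (kappaSU N)) z * R (expFibreChartSU b c z))
      =ᵐ[volume] ({z | U z < θ} ∩ C).indicator fun z => K.indicator (fun w => ENNReal.ofReal (Real.exp (-φ w))) z) :
    SlotAntiConcentration (termFibreLawOfDatum₉ F N ϑ Dt g₀ os p g k t s b x) (blockReading N u b x) θ ρ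
      (3 * ((b.card : ℝ) * dimSU N + 1) * (1 + Q) / (κ₀ * (1 - ρ))) := by
  have hA : MeasurableSet ({z | U z < θ} ∩ C) := (measurableSet_lt hUm measurable_const).inter hC
  have h1 := slotAntiConcentration_blockChartSU_of_sect1Letters hN b hb K φ Qf lin Vt hg hUm hC hEnv hθ hρ0 hρ1 hρσ hκ
    hQ0 hL hd hM hγ₀ hW hK hφ h0K hexp h19 h16 hV hUL hUc hclause henv hRT hQ
  rw [restrict_withDensity hA, ← withDensity_indicator hA, ← withDensity_congr_ae hdens] at h1
  have hform : (fun z : BlockChartSU N b => chartWeightSU b S (expJacWeightSU (kappaSU N)) z * R (expFibreChartSU b c z)) =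
      (closedBall (0 : BlockChartSU N b) S).indicator
        fun z => (∏ i, expJacWeightSU (kappaSU N) (z i)) * R (expFibreChartSU b c z) := by
    funext z
    show (closedBall (0 : BlockChartSU N b) S).indicator (fun z' => ∏ i, expJacWeightSU (kappaSU N) (z' i)) z *
        R (expFibreChartSU b c z) = _
    exact (Set.indicator_mul_left (closedBall (0 : BlockChartSU N b) S)
      (fun z' => ∏ i, expJacWeightSU (kappaSU N) (z' i)) fun z' => R (expFibreChartSU b c z')).symm
  rw [hform] at h1
  have h2 : SlotAntiConcentration ((volume : Measure (BlockChartSU N b)).withDensity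
      ((closedBall (0 : BlockChartSU N b) S).indicator
        fun z => (∏ i, expJacWeightSU (kappaSU N) (z i)) * R (expFibreChartSU b c z)))
      (blockReading N u b x ∘ expFibreChartSU b c) θ ρ (3 * ((b.card : ℝ) * dimSU N + 1) * (1 + Q) / (κ₀ * (1 - ρ))) :=
    slotAntiConcentration_congr_support volume measurableSet_closedBall _ (fun z hz => (hread z hz).symm) h1
  rw [← hform] at h2
  exact slotAC_termFibreLaw_of_chartAC F N ϑ Dt g₀ os p g k t s b x hS hSπ c hR hlaw (measurable_blockReading hu b x) h2

end AtRecord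

/-! ## §4  A6 witnesses: every binder of the ★★★★ END discharged in the kernel (`N = 2`, `d_2 = 3`) -/

section Witness

variable {N : ℕ} {P : Params} {j : ℕ}

/-- the half sum of the squared bond norms `z ↦ ½ Σ_{b′} ‖z b′‖²` is convex on the block chart space (`‖·‖` convex and
`t ↦ t²` convex monotone: `(a s + c t)² ≤ a s² + c t²` for `a + c = 1`). [textbook] -/
theorem convexOn_halfSumNormSq (b : Finset (PBond P j)) :
    ConvexOn ℝ univ fun z : BlockChartSU N b => (∑ i, ‖z i‖ ^ 2) / 2 := by
  refine ⟨convex_univ, fun x _ y _ a c ha hc hac => ?_⟩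
  have key : ∀ i, ‖(a • x + c • y) i‖ ^ 2 ≤ a * ‖x i‖ ^ 2 + c * ‖y i‖ ^ 2 := fun i => by
    have h1 : ‖(a • x + c • y) i‖ ≤ a * ‖x i‖ + c * ‖y i‖ := by
      rw [Pi.add_apply, Pi.smul_apply, Pi.smul_apply]
      refine (norm_add_le _ _).trans (le_of_eq ?_)
      rw [norm_smul, norm_smul, Real.norm_of_nonneg ha, Real.norm_of_nonneg hc]
    have h2 : ‖(a • x + c • y) i‖ ^ 2 ≤ (a * ‖x i‖ + c * ‖y i‖) ^ 2 := pow_le_pow_left₀ (norm_nonneg _) h1 2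
    have hc' : c = 1 - a := by linarith
    subst hc'
    nlinarith [h2, mul_nonneg (mul_nonneg ha hc) (sq_nonneg (‖x i‖ - ‖y i‖)), norm_nonneg (x i), norm_nonneg (y i)]
  have hsum := Finset.sum_le_sum fun i (_ : i ∈ (Finset.univ : Finset ↥b)) => key i
  rw [Finset.sum_add_distrib, ← Finset.mul_sum, ← Finset.mul_sum] at hsum
  simp only [smul_eq_mul]
  linarith

/-- **A6 WITNESS OF THE ★★★★ END, FOR EVERY NONEMPTY BLOCK OF EVERY LATTICE** (director-ym STANDING A6 RULE №189 (3)):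
`N = 2` (so `d_N = 3`, `dimSU_eq`), `K = univ`, `φ(z) = ½Σ_{b′} ‖z b′‖²` (expansion `Q z = Σ_{b′} ‖z b′‖²`, `lin = 0`, `Vt = 0`),
rows at `γ₀ = 1`, `d = 1`, `M = 1∕100` (`100M = 1`), `B₃ = 1∕144`, `M₀ = A₀ = p₀(g) = 1`, `R_k = 0` (`W = 1∕48`), letter
`θ = 2`, `ρ = ½`: the clause `16·(1∕48)·1·1·3 = 1 = 1·(2·½)²` WITH EQUALITY.  A satisfiability witness of the binder list,
not an estimate on Bałaban's measure. [textbook] -/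
theorem chartLetter_blockChartSU_binders_inhabited (b : Finset (PBond P j)) (hb : b.Nonempty) :
    SlotAntiConcentration
      (((volume : Measure (BlockChartSU 2 b)).withDensity fun z =>
          (univ : Set (BlockChartSU 2 b)).indicator
            (fun w => ENNReal.ofReal (Real.exp (-((∑ i, ‖w i‖ ^ 2) / 2)))) z).restrict
        ({z : BlockChartSU 2 b | ‖z‖ < 2} ∩ univ))
      (fun z : BlockChartSU 2 b => ‖z‖) 2 (1 / 2) (3 * ((b.card : ℝ) * dimSU 2 + 1) * (1 + 0) / (1 * (1 - 1 / 2))) := by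
  have hφc : Continuous fun w : BlockChartSU 2 b => (∑ i, ‖w i‖ ^ 2) / 2 :=
    (continuous_finsetSum _ fun i _ => ((continuous_apply i).norm).pow 2).div_const 2
  have hg : Measurable fun z : BlockChartSU 2 b => (univ : Set (BlockChartSU 2 b)).indicator
      (fun w => ENNReal.ofReal (Real.exp (-((∑ i, ‖w i‖ ^ 2) / 2)))) z := by
    simp only [indicator_univ]
    exact ENNReal.measurable_ofReal.comp (Real.measurable_exp.comp hφc.measurable.neg)
  have hd2 : (dimSU 2 : ℝ) = 3 := by
    rw [dimSU_eq]
    norm_num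
  refine slotAntiConcentration_blockChartSU_chartLetter le_rfl b hb univ (fun w => (∑ i, ‖w i‖ ^ 2) / 2)
    (fun w => ∑ i, ‖w i‖ ^ 2) (fun _ => 0) (fun _ => 0) hg (γ₀ := 1) (M := 1 / 100) (B₃ := 1 / 144) (M₀ := 1)
    (A₀ := 1) (p₀g := 1) (Rk := 0) (WV := 0) (d := 1) two_pos (by norm_num) (by norm_num) le_rfl (by norm_num) one_pos
    ?_ convex_univ (convexOn_halfSumNormSq b) (mem_univ _) ?_ ?_ ?_ ?_ ?_
  · -- hW
    simp
  · -- hexp: `φ z = φ 0 + ½·Q z + 0 + 0`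
    intro v _
    show (∑ i, ‖v i‖ ^ 2) / 2 = (∑ i, ‖(0 : BlockChartSU 2 b) i‖ ^ 2) / 2 + 1 / 2 * (∑ i, ‖v i‖ ^ 2) + 0 + 0
    have h0 : (∑ i, ‖(0 : BlockChartSU 2 b) i‖ ^ 2) = 0 := by simp
    rw [h0]
    ring
  · -- h19 (1.9) as a real inequality: `½·Σ ≤ Σ`
    intro v _
    have hS : 0 ≤ ∑ i, ‖v i‖ ^ 2 := Finset.sum_nonneg fun i _ => sq_nonneg _
    show (1 : ℝ) / (2 * ((1 : ℕ) : ℝ) * (100 * (1 / 100)) ^ (1 + 1)) * (∑ i, ‖v i‖ ^ 2) ≤ ∑ i, ‖v i‖ ^ 2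
    calc (1 : ℝ) / (2 * ((1 : ℕ) : ℝ) * (100 * (1 / 100)) ^ (1 + 1)) * (∑ i, ‖v i‖ ^ 2)
        = 1 / 2 * (∑ i, ‖v i‖ ^ 2) := by norm_num
      _ ≤ ∑ i, ‖v i‖ ^ 2 := by linarith
  · -- h16 (1.6): `|0| < 3·(1/144)·…`
    intro v _
    unfold Ineq16
    norm_num
  · -- hV
    intro v _
    simp
  · -- the clause WITH EQUALITY (`dimSU 2 = 3`)
    rw [hd2]
    norm_num

/-- … and the data exist: ONE CONCRETE BOND — the lattice `Params.mk 1 3 0 0 …` (`d = 1`, `L = 3`), scale `j = 0`, the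
block of the single bond `⟨default, 0⟩` — so the binder list of ★★★★ is inhabited outright. [textbook] -/
theorem chartLetter_blockChartSU_binders_inhabited_oneBond :
    ∃ (P : Params) (j : ℕ) (b : Finset (PBond P j)), b.Nonempty ∧
      SlotAntiConcentration
        (((volume : Measure (BlockChartSU 2 b)).withDensity fun z =>
            (univ : Set (BlockChartSU 2 b)).indicator
              (fun w => ENNReal.ofReal (Real.exp (-((∑ i, ‖w i‖ ^ 2) / 2)))) z).restrict
          ({z : BlockChartSU 2 b | ‖z‖ < 2} ∩ univ))
        (fun z : BlockChartSU 2 b => ‖z‖) 2 (1 / 2) (3 * ((b.card : ℝ) * dimSU 2 + 1) * (1 + 0) / (1 * (1 - 1 / 2))) :=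
  ⟨Params.mk 1 3 0 0 le_rfl ⟨⟨1, rfl⟩, Nat.one_lt_two.trans (Nat.lt_succ_self 2)⟩, 0, {⟨default, 0⟩},
    Finset.singleton_nonempty _, chartLetter_blockChartSU_binders_inhabited _ (Finset.singleton_nonempty _)⟩

end Witness

end Summit.QuantumFields.YangMills.Theorems.N21LowCentreEndAtSUNBlockChartRecord

end
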